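import Literature.NumberTheory.Automorphic.Liu2021.AppendixC.EtaleBettiComparison
import HarnessLib

/-!
# [Liu 2021, §4.2 l. 2070–2081] functoriality of the Betti pull-back `f^*` on `H¹((A ×_{E,τ'} ℂ)(ℂ); ℂ)` and
# TRANSPORT of a Betti pinning along Hecke-compatible isomorphisms of two Albanese towers

Topic `NumberTheory/Automorphic/Liu2021/AppendixC`; namespace `Literature.NumberTheory.Automorphic.Liu2021.AppendixC`.
Continuation of `EtaleBettiComparison.lean` (§2 `bettiH1Along` / `bettiPullAlong`, §4 `Sec42Data.BettiPinning`).

* §1 `bettiPullAlong_comp`, `bettiPullAlong_id` — `(f ≫ g)^* = f^* ∘ g^*`, `𝟙^* = id`: «By functoriality» (l. 2070); the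
  kernel content is `AbelianVariety.Hom.baseChange_comp/_id` (base change `A ↦ A ×_{E,τ'} ℂ` is a functor), `AlgPoints.mapContinuous`
  functoriality and the contravariance of singular cohomology (`complexBetti.map_comp/_id`).  Corollaries for isomorphisms
  (`bettiPullAlong_hom_inv_apply`, `bettiPullAlong_inv_hom_apply`, bijectivity).
* §2 `Sec42Data.BettiPinning.nonempty_transport` — given two §4.2 data `C`, `C'` (over possibly DIFFERENT `PropC5Data` terms),
  maps `eG : C.G → C'.G`, `eK` on small levels (surjective) respecting `HeckeLE`, isomorphisms `α_K : A_K ≅ A'_{eK K}` of the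
  Albanese varieties intertwining the Hecke translates (`Alb(T_g) ≫ α_{K'} = α_K ≫ Alb(T'_{eG g})`), and a Betti tower `(H, rhoB)`
  of `C` whose action factors through `eG` into `rhoB'`, every Betti pinning of `(H, rhoB')` to the levels of `C'` transports to a
  Betti pinning of `(H, rhoB)` to the levels of `C`: `b_K := b'_{eK K} ∘ (α_K⁻¹)^*`.  (The «END» of the cell hodgecm-mathlib's
  hLiu418 off-place face instantiates `eG`, `eK`, `eh` by identities.)

Kernel lemmas only (no named fact, no `def`, debt 0).  HC_CM is NOT proved here; nothing of [Liu2021] is discharged.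

## References
* [Liu2021] Y. Liu, Camb. J. Math. 9 (2021) = arXiv:2102.11518: §4.2 l. 2070 («By functoriality»), l. 2074 (the Hecke
  homomorphism `𝔾(𝔸_F^∞) → Aut_E(A_∞)`), l. 2079–2081 (`H¹_{B,τ'}(A_∞, ℂ) := colim_K H¹_{B,τ'}(A_K, ℂ)`).
* [Hatcher2002] A. Hatcher, *Algebraic Topology*, §3.1 («Induced homomorphisms»: `(g ∘ f)^* = f^* ∘ g^*`, `𝟙^* = 𝟙`).
* Tree: `AppendixC.EtaleBettiComparison` (`bettiPullAlong_def`, `Sec42Data.BettiPinning`), `Motives.AbelianVarietyBaseChange`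
  (`Hom.baseChange_comp/_id`), `Motives.BettiRealization` (`AlgPoints.mapContinuous_comp/_id`), `HodgeTheory.GysinFormalism`
  (`complexBetti.map_comp/_id`).
-/

noncomputable section

open CategoryTheory NumberField

namespace Literature.NumberTheory.Automorphic.Liu2021.AppendixC

open Literature.AlgebraicGeometry.Motives (AbelianVariety AlgPoints)
open Literature.AlgebraicGeometry.HodgeTheory (complexBetti)

/-! ## §1 Functoriality of `bettiPullAlong` -/

section Betti

variable {E : Type} [Field E]

/-- `bettiPullAlong τ' f` is the `ℂ`-linear map underlying `complexBetti.map` of the base-changed morphism `f ×_{τ'} ℂ`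
(unfolding; both are singular cohomology of `AlgPoints.mapContinuous`). [cite: Liu2021, §4.2 l. 2070–2079] -/
theorem bettiPullAlong_eq_complexBetti_map (τ' : E →+* ℂ) {A B : AbelianVariety E} (f : A ⟶ B) :
    bettiPullAlong τ' f =
      letI : Algebra E ℂ := algebraAlong E τ'
      (complexBetti.map (AbelianVariety.Hom.baseChange ℂ f).hom.hom.hom 1).hom :=
  rfl

/-- **`(f ≫ g)^* = f^* ∘ g^*`** on `H¹_{B,τ'}(–, ℂ)` — «By functoriality» (l. 2070): base change along `τ'` is a functor
(`Hom.baseChange_comp`) and singular cohomology is contravariant (`complexBetti.map_comp`).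
[cite: Liu2021, §4.2 l. 2070] [cite: Hatcher2002, §3.1] -/
theorem bettiPullAlong_comp (τ' : E →+* ℂ) {A B D : AbelianVariety E} (f : A ⟶ B) (g : B ⟶ D) :
    bettiPullAlong τ' (f ≫ g) = bettiPullAlong τ' f ∘ₗ bettiPullAlong τ' g := by
  letI : Algebra E ℂ := algebraAlong E τ'
  rw [bettiPullAlong_eq_complexBetti_map, bettiPullAlong_eq_complexBetti_map, bettiPullAlong_eq_complexBetti_map,
    AbelianVariety.Hom.baseChange_comp]
  change (complexBetti.map ((AbelianVariety.Hom.baseChange ℂ f).hom.hom.hom ≫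
      (AbelianVariety.Hom.baseChange ℂ g).hom.hom.hom) 1).hom = _
  rw [complexBetti.map_comp, ModuleCat.hom_comp]

/-- **`𝟙^* = id`** on `H¹_{B,τ'}(A, ℂ)` (`Hom.baseChange_id`, `complexBetti.map_id`).
[cite: Liu2021, §4.2 l. 2070] [cite: Hatcher2002, §3.1] -/
theorem bettiPullAlong_id (τ' : E →+* ℂ) (A : AbelianVariety E) : bettiPullAlong τ' (𝟙 A) = LinearMap.id := by
  letI : Algebra E ℂ := algebraAlong E τ'
  rw [bettiPullAlong_eq_complexBetti_map, AbelianVariety.Hom.baseChange_id]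
  change (complexBetti.map (𝟙 (A.baseChange ℂ).X) 1).hom = _
  rw [complexBetti.map_id, ModuleCat.hom_id]

/-- `(f ≫ g)^* y = f^* (g^* y)`. [cite: Liu2021, §4.2 l. 2070] [cite: Hatcher2002, §3.1] -/
theorem bettiPullAlong_comp_apply (τ' : E →+* ℂ) {A B D : AbelianVariety E} (f : A ⟶ B) (g : B ⟶ D)
    (y : bettiH1Along D τ') : bettiPullAlong τ' (f ≫ g) y = bettiPullAlong τ' f (bettiPullAlong τ' g y) := by
  rw [bettiPullAlong_comp, LinearMap.comp_apply]

/-- `𝟙^* y = y`. [cite: Liu2021, §4.2 l. 2070] [cite: Hatcher2002, §3.1] -/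
theorem bettiPullAlong_id_apply (τ' : E →+* ℂ) {A : AbelianVariety E} (y : bettiH1Along A τ') :
    bettiPullAlong τ' (𝟙 A) y = y := by
  rw [bettiPullAlong_id, LinearMap.id_apply]

/-- for an isomorphism `e : A ≅ B`: `e.hom^* (e.inv^* y) = y`. [cite: Liu2021, §4.2 l. 2070] [cite: Hatcher2002, §3.1] -/
theorem bettiPullAlong_hom_inv_apply (τ' : E →+* ℂ) {A B : AbelianVariety E} (e : A ≅ B) (y : bettiH1Along A τ') :
    bettiPullAlong τ' e.hom (bettiPullAlong τ' e.inv y) = y := by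
  rw [← bettiPullAlong_comp_apply, e.hom_inv_id, bettiPullAlong_id_apply]

/-- for an isomorphism `e : A ≅ B`: `e.inv^* (e.hom^* y) = y`. [cite: Liu2021, §4.2 l. 2070] [cite: Hatcher2002, §3.1] -/
theorem bettiPullAlong_inv_hom_apply (τ' : E →+* ℂ) {A B : AbelianVariety E} (e : A ≅ B) (y : bettiH1Along B τ') :
    bettiPullAlong τ' e.inv (bettiPullAlong τ' e.hom y) = y := by
  rw [← bettiPullAlong_comp_apply, e.inv_hom_id, bettiPullAlong_id_apply]

/-- pull-back along an isomorphism is a bijection. [cite: Liu2021, §4.2 l. 2070] [cite: Hatcher2002, §3.1] -/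
theorem bettiPullAlong_bijective_of_isIso (τ' : E →+* ℂ) {A B : AbelianVariety E} (e : A ≅ B) :
    Function.Bijective (bettiPullAlong τ' e.hom) :=
  ⟨Function.LeftInverse.injective (g := bettiPullAlong τ' e.inv) (bettiPullAlong_inv_hom_apply τ' e),
    Function.RightInverse.surjective (g := bettiPullAlong τ' e.inv) (bettiPullAlong_hom_inv_apply τ' e)⟩

/-- pull-back along the inverse of an isomorphism is injective. [cite: Liu2021, §4.2 l. 2070] [cite: Hatcher2002, §3.1] -/
theorem bettiPullAlong_inv_injective (τ' : E →+* ℂ) {A B : AbelianVariety E} (e : A ≅ B) :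
    Function.Injective (bettiPullAlong τ' e.inv) :=
  Function.LeftInverse.injective (g := bettiPullAlong τ' e.hom) (bettiPullAlong_hom_inv_apply τ' e)

end Betti

/-! ## §2 Transport of a Betti pinning along Hecke-compatible isomorphisms of the Albanese towers -/

variable {F E : Type} [Field F] [NumberField F] [IsTotallyReal F] [Field E] [NumberField E] [Algebra F E]
  [IsTotallyComplex E] [Algebra.IsQuadraticExtension F E]

/-- **Transport of a Betti pinning.**  Two §4.2 data `C`, `C'` (over possibly different `PropC5Data` terms), a map of Hecke
groups `eG : C.G → C'.G` and a SURJECTIVE map of small levels `eK` respecting admissibility of pairs (`eh`), isomorphisms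
`α_K : A_K ≅ A'_{eK K}` of the Albanese varieties INTERTWINING the Hecke translates (`Alb(T_g) ≫ α_{K'} = α_K ≫ Alb(T'_{eG g})`),
and a Betti tower `(H, rhoB)` of `C` with `rhoB g = rhoB' (eG g)`: a Betti pinning `B'` of `(H, rhoB')` to the levels of `C'`
transports to the pinning `b_K := b'_{eK K} ∘ (α_K⁻¹)^*` of `(H, rhoB)` to the levels of `C` — injective (pull-back along an
isomorphism is bijective), Hecke (`(α_{K'}⁻¹)^* ∘ Alb(T'_{eG g})^* = Alb(T_g)^* ∘ (α_K⁻¹)^*` by functoriality, l. 2070), exhaustive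
(`eK` surjective and `(α_K)^*` bijective).  «the Hecke correspondences provide a homomorphism `𝔾(𝔸_F^∞) → Aut_E(A_∞)`» read on
`H¹_{B,τ'}(A_∞, ℂ) := colim_K H¹_{B,τ'}(A_K, ℂ)`, transported along an isomorphism of towers.
[cite: Liu2021, §4.2 l. 2070–2081] [cite: Hatcher2002, §3.1] -/
theorem Sec42Data.BettiPinning.nonempty_transport
    {P : PropC5Data F E} {iso : ℕ → Prop} {C : Sec42Data P iso} (T : C.HeckeTranslates)
    {P' : PropC5Data F E} {iso' : ℕ → Prop} {C' : Sec42Data P' iso'} (T' : C'.HeckeTranslates)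
    (eG : C.G → C'.G) (eK : C5.SmallLevel C.S.K₀ → C5.SmallLevel C'.S.K₀) (heK : Function.Surjective eK)
    (eh : ∀ {g : C.G} {K K' : C5.SmallLevel C.S.K₀}, C5.HeckeLE g K K' → C5.HeckeLE (eG g) (eK K) (eK K'))
    (α : ∀ K : C5.SmallLevel C.S.K₀, C.A K ≅ C'.A (eK K))
    (hα : ∀ (g : C.G) (K K' : C5.SmallLevel C.S.K₀) (h : C5.HeckeLE g K K'),
      T.albTr g K K' h ≫ (α K').hom = (α K).hom ≫ T'.albTr (eG g) (eK K) (eK K') (eh h))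
    {τ' : E →+* ℂ} {H : Type} [AddCommGroup H] [Module ℂ H] {rhoB : Representation ℂ C.G H}
    {rhoB' : Representation ℂ C'.G H} (hρ : ∀ g, rhoB g = rhoB' (eG g)) (B' : C'.BettiPinning T' τ' H rhoB') :
    Nonempty (C.BettiPinning T τ' H rhoB) := by
  -- the intertwining relation, rewritten with the inverses: `Alb(T'_{eG g}) ≫ α_{K'}⁻¹ = α_K⁻¹ ≫ Alb(T_g)`
  have hα' : ∀ (g : C.G) (K K' : C5.SmallLevel C.S.K₀) (h : C5.HeckeLE g K K'),
      T'.albTr (eG g) (eK K) (eK K') (eh h) ≫ (α K').inv = (α K).inv ≫ T.albTr g K K' h := by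
    intro g K K' h
    rw [Iso.comp_inv_eq, Category.assoc, Iso.eq_inv_comp, hα]
  refine ⟨{ b := fun K => B'.b (eK K) ∘ₗ bettiPullAlong τ' (α K).inv
            b_injective := fun K => (B'.b_injective (eK K)).comp (bettiPullAlong_inv_injective τ' (α K))
            b_hecke := ?_
            exhaust := ?_ }⟩
  · intro g K K' h y
    rw [LinearMap.comp_apply, LinearMap.comp_apply, hρ g, B'.b_hecke (eG g) (eK K) (eK K') (eh h),
      ← bettiPullAlong_comp_apply, hα' g K K' h, bettiPullAlong_comp_apply]
  · intro x
    obtain ⟨K₁, y', rfl⟩ := B'.exhaust x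
    obtain ⟨K, rfl⟩ := heK K₁
    exact ⟨K, bettiPullAlong τ' (α K).hom y', by rw [LinearMap.comp_apply, bettiPullAlong_inv_hom_apply]⟩

end Literature.NumberTheory.Automorphic.Liu2021.AppendixC

end
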